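import Summits.QuantumFields.YangMills.Theorems.ToronCumulantSignCommutatorSkewMoment
import Summits.QuantumFields.YangMills.Theorems.ToronCumulantSignOneSiteCovDerivative
import Summits.QuantumFields.YangMills.Theorems.ToronCumulantSignOneSiteCovAtZero

/-!
# The barrier fact `ToronPlaneAnticorrelation` DISCHARGED: Griffiths II fails for `SU(N)` plaquette energies, every `N ≥ 2`

★★★ `Literature.Barriers.QuantumFields.ToronPlaneAnticorrelation` — for every `N ≥ 2` there are a periodic torus `(ℤ/L)⁴` and a
coupling `β > 0` at which the `SU(N)` Wilson plaquette energies `Re tr U_p` of the two plaquettes through the origin in complementary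
planes are NEGATIVELY correlated — is now a theorem (`toronPlaneAnticorrelation_holds`), by witness (W1) of the barrier file: the
one-site (Eguchi–Kawai) torus `L = 1`, where `Cov_β(Re tr U_(0;01), Re tr U_(0;23))` vanishes at `β = 0` (support
`oneSiteCovAtZero_proof`) and has derivative `(4/N²)·κ_N` there (crux `oneSiteCovDerivative_proof`) with the exact two-matrix Haar
moment `κ_N = ∫∫(|tr X|²−1)(|tr Y|²−1) Re tr(XYX⁻¹Y⁻¹) = −1/(N(N²−1)) < 0` (crux `commutatorSkewMoment_proof`); the route's deciding
theorem `ToronCumulantSign.closes` turns `f(0) = 0, f′(0) < 0` into `f(β) < 0` for some small `β > 0`.  Consequently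
(`exists_arena_not_forall_admits`) for every `N ≥ 2` NO product-closed local association criterion (FKG/Holley, Ginibre systems,
monotone couplings; `LocalAssociationCriterion`) admits all the `SU(N)` Wilson plaquette terms of that arena — the blocking theorem
`ToronPlaneAnticorrelation.exists_not_forall_admits` of the barrier file, now unconditional.

HONEST LABEL: a BARRIER-LEDGER result (a certified obstruction: positive association of non-abelian plaquette energies cannot be
certified by any product-closed local criterion); it proves nothing about any LADDER-YM rung, `NT`, or the Yang–Mills mass gap.

References: B. Collins, P. Śniady, CMP 264 (2006) 773–795 [CollinsSniady2006]; J. Ginibre, CMP 16 (1970) 310–328 [Ginibre1970];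
K. Wilson, Phys. Rev. D 10 (1974) 2445 [Wilson1974].
-/

namespace Summit.QuantumFields.YangMills.Theorems.ToronCumulantSign

/-- ★★★ **The barrier fact `ToronPlaneAnticorrelation` holds**: for every `N ≥ 2` some `SU(N)` Wilson torus has a negatively
correlated complementary-plane plaquette pair (one-site witness, first `β`-cumulant `−4/(N³(N²−1))`). -/
theorem toronPlaneAnticorrelation_holds : Literature.Barriers.QuantumFields.ToronPlaneAnticorrelation :=
  Summit.QuantumFields.YangMills.Theses.ToronCumulantSign.closes commutatorSkewMoment_proof oneSiteCovDerivative_proof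
    oneSiteCovAtZero_proof

/-- **The barrier, unconditionally**: for every `N ≥ 2` there is an arena `(ℤ/L)⁴, β > 0` on which no product-closed local
association criterion admits all the `SU(N)` Wilson plaquette terms. -/
theorem exists_arena_not_forall_admits {N : ℕ} (hN : 2 ≤ N) :
    ∃ (L : ℕ) (_ : NeZero L) (β : ℝ), 0 < β ∧
      ∀ K : Literature.Barriers.QuantumFields.LocalAssociationCriterion 4 L (Matrix.specialUnitaryGroup (Fin N) ℂ)
          (Literature.MathematicalPhysics.QuantumLattice.fundamentalRep (Fin N)),
        ¬ ∀ r : Literature.MathematicalPhysics.QuantumFieldTheory.Plaquette 4 L,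
          K.Admits (Literature.Barriers.QuantumFields.plaquetteTerm
            (Literature.MathematicalPhysics.QuantumLattice.fundamentalRep (Fin N)) β r) :=
  toronPlaneAnticorrelation_holds.exists_not_forall_admits hN

end Summit.QuantumFields.YangMills.Theorems.ToronCumulantSign
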